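import Summits.ResolutionOfSingularities.ResolutionOfSingularities.Theorems.MarkedTransferCampaignW46MohWindowSurfaceStallThread
import Summits.ResolutionOfSingularities.ResolutionOfSingularities.Theorems.MarkedTransferCampaignW46MohWindowSurfaceChildCount
import Summits.ResolutionOfSingularities.ResolutionOfSingularities.Theorems.MarkedTransferCampaignW46MohWindowSurfaceHeavyCore
import Summits.ResolutionOfSingularities.ResolutionOfSingularities.Theorems.MarkedTransferCampaignW46MohWindowSurfaceHeavyChart
import Summits.ResolutionOfSingularities.ResolutionOfSingularities.Theorems.MarkedTransferCampaignW46MohWindowSurfaceHeavyRootChart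
import HarnessLib

/-!
# [OURS · L1 W4.6 rung (iii-2), EVERY `p`] Surface Moh window — THE HEAVY ROOT UNDER A NON-DROPPING CHILD: res-D-pv-050's chart datum
# with the prime of the point made EXPLICIT, and the location of non-dropping children on the exceptional line (cell res-hironaka,
# LADDER-RESOLUTION rung L, D-0089; seat res-L1-s46-pv-5 gen 5; host MarkedTransfer, `--supports stmt-ResolutionOfSingularities-16155
# --as helper`; statement file `…CampaignW46MohWindowSurface.lean`)

HONEST FRAMING. Nothing here is a statement of H. Hironaka's manuscript [Hironaka2017] and nothing here asserts that any
statement of it holds. The stalling thread (`…StallThread.lean`) of an infinite in-regime sequence is blown up infinitely often with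
NON-DROPPING residual order. This file locates such a child: res-D-pv-050's chart datum (`…HeavyChart.lean`,
`exists_core_data_of_chartDatum_of_factor` / `exists_core_data_of_factor`) is re-run with the factorisation hypothesis required ONLY
for the prime `π` of `κ[Y]` UNDER THE POINT (`exists_core_data_of_chartDatum_at`, `exists_core_data_at` — same proofs, the prime made
explicit), so that res-D-pv-050's bound `d″ + p ≤ d + μ` (`core_le_window`) holds with `μ` the multiplicity of THAT prime; if the child
does not drop (`d″ ≥ d`) then `μ ≥ p`, the prime is LINEAR, `π = ᾱ Y + β̄`, `π^p` divides the chart's residue polynomial (the centre is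
HEAVY with `κ`-rational heavy root `−β̄/ᾱ`) and the child lies ON THE LINE `{c_j = 0, z/c_j = 0}` AT THAT ROOT (`α̃ · y/c_j + β̃ ∈ 𝔴`;
`exponent_lt_or_heavyRoot_of_chart`). This is the coordinate information the (H2) entrance door needs along a heavy thread. AI-written; AI
review is weaker than expert review. No `sorry`; axioms standard.
[ZariskiSamuel1960] [Matsumura1987] [HauserWagner2014] [CossartPiltant2008]
-/

noncomputable section

set_option linter.dupNamespace false -- mandated namespace of this single-conjunct summit

namespace Summit.ResolutionOfSingularities.ResolutionOfSingularities.Theorems.CampaignW46.MohWindowSurface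

open IsLocalRing Polynomial
open Literature.AlgebraicGeometry.Resolution

universe u

variable {R : Type u} [CommRing R] [IsRegularLocalRing R]

/-! ## 2. The Rees chart, hypothesis localized at the point -/

set_option maxHeartbeats 800000 in
-- the composite `θ` (coefficient change + `chartQuotEquiv`) makes the final unification expensive across the file boundary
/-- **res-D-pv-050's Rees-chart datum, factorisation hypothesis LOCALIZED AT THE POINT** (`exists_core_data_of_factor`, same proof): the
factorisation with `P μ` is required only for primes `π` of `κ[Y]` all of whose lifts `π̃ ∈ R[Y]` satisfy `π̃(c_{i′}/c_i) ∈ 𝔴` (the prime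
UNDER THE POINT). NOT a statement of the manuscript. [folklore] -/
theorem exists_core_data_at (h3 : (maximalIdeal R).spanFinrank = 3) (c : Fin 3 → R)
    (hc : Ideal.span (Set.range c) = maximalIdeal R) {i i' : Fin 3} (hi : i ≠ 2) (hi' : i' ≠ 2) (hii' : i ≠ i')
    {d : ℕ} (a : ℕ → R) (u : ℕ → ℕ) {P : ℕ → Prop}
    (𝔴 : Ideal (chartRing c i)) [𝔴.IsPrime] (h𝔴 : 𝔴.comap (chartBase c i) = maximalIdeal R)
    (hfac : ∀ π : (ResidueField R)[X], Prime π →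
      (∀ πR : R[X], Polynomial.map (residue R) πR = π → πR.eval₂ (chartBase c i) (chartGen c i i') ∈ 𝔴) →
      ∃ (μ : ℕ) (G₀ : (ResidueField R)[X]),
      P μ ∧ (∑ k ∈ Finset.range (d + 1), C (residue R (a k)) * X ^ (u k)) = π ^ μ * G₀ ∧ ¬ π ∣ G₀)
    (L : Type u) [CommRing L] [IsLocalRing L] [Algebra (chartRing c i) L] [IsLocalization.AtPrime L 𝔴]
    (h3L : (maximalIdeal L).spanFinrank = 3)
    (hz : (algebraMap (chartRing c i) L : chartRing c i →+* L) (chartGen c i 2) ∈ maximalIdeal L) :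
    IsRegularLocalRing L ∧
    ∃ (ρ G : L) (μ : ℕ), P μ ∧ IsUnit G ∧
      Ideal.span {(algebraMap (chartRing c i) L : chartRing c i →+* L) (chartBase c i (c i)), ρ,
          (algebraMap (chartRing c i) L : chartRing c i →+* L) (chartGen c i 2)} = maximalIdeal L ∧
      (∑ k ∈ Finset.range (d + 1), (algebraMap (chartRing c i) L : chartRing c i →+* L) (chartBase c i (a k)) *
          (algebraMap (chartRing c i) L : chartRing c i →+* L) (chartGen c i i') ^ (u k)) - ρ ^ μ * G ∈
        Ideal.span {(algebraMap (chartRing c i) L : chartRing c i →+* L) (chartBase c i (c i))} := by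
  classical
  -- the padded rsop and quasi-regularity
  have hz0 : Ideal.span (Set.range (Fin.append c (fun k : Fin 0 => Fin.elim0 k : Fin 0 → R))) = maximalIdeal R := by
    rw [span_range_append_elim0]; exact hc
  have hd0 : (maximalIdeal R).spanFinrank = 3 + 0 := by rw [h3]
  have hqr : IsQuasiRegular c := isQuasiRegular_centre c (fun k : Fin 0 => Fin.elim0 k) hz0 hd0
  -- `L` is regular: the chart family with no extra letters
  have hrsop := isRsopPart_chartFamily_reesChart c i (fun k : Fin 0 => Fin.elim0 k) hz0 hd0 𝔴 h𝔴 L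
    (a := 0) (fun k : Fin 0 => Fin.elim0 k) (Function.injective_of_subsingleton _) (fun k => Fin.elim0 k)
  refine ⟨hrsop.isRegularLocalRing, ?_⟩
  have hci𝔴 : chartBase c i (c i) ∈ 𝔴 := by
    have : c i ∈ 𝔴.comap (chartBase c i) := by rw [h𝔴, ← hc]; exact Ideal.subset_span ⟨i, rfl⟩
    exact this
  have he2𝔴 : chartGen c i 2 ∈ 𝔴 := (IsLocalization.AtPrime.to_map_mem_maximal_iff L 𝔴 _).mp hz
  have hK𝔴' : Ideal.span {chartBase c i (c i)} ≤ 𝔴 := by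
    rw [Ideal.span_le, Set.singleton_subset_iff]; exact hci𝔴
  -- the exceptional plane over the residue field: `κ[Y, Z] ≃ B/(c_i)` (tree `chartQuotEquiv` after `R/(c) = R/𝔪 = κ`)
  let θ : MvPolynomial {j : Fin 3 // j ≠ i} (ResidueField R) ≃+* chartRing c i ⧸ Ideal.span {chartBase c i (c i)} :=
    (MvPolynomial.mapEquiv {j : Fin 3 // j ≠ i} (Ideal.quotEquivOfEq hc).symm).trans (chartQuotEquiv c i hqr)
  have hθC : ∀ r : R, θ (MvPolynomial.C (residue R r)) =
      Ideal.Quotient.mk (Ideal.span {chartBase c i (c i)}) (chartBase c i r) := fun r => by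
    show chartQuotMap c i (MvPolynomial.map (Ideal.quotEquivOfEq hc).symm.toRingHom (MvPolynomial.C (residue R r))) = _
    have : (Ideal.quotEquivOfEq hc).symm.toRingHom (residue R r) = Ideal.Quotient.mk (Ideal.span (Set.range c)) r := by
      show (Ideal.quotEquivOfEq hc).symm (Ideal.Quotient.mk (maximalIdeal R) r) = _
      rw [Ideal.quotEquivOfEq_symm, Ideal.quotEquivOfEq_mk]
    rw [MvPolynomial.map_C, this, chartQuotMap_C]
  have hθX : ∀ s : {j : Fin 3 // j ≠ i}, θ (MvPolynomial.X s) =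
      Ideal.Quotient.mk (Ideal.span {chartBase c i (c i)}) (chartGen c i s.1) := fun s => by
    show chartQuotMap c i (MvPolynomial.map (Ideal.quotEquivOfEq hc).symm.toRingHom (MvPolynomial.X s)) = _
    rw [MvPolynomial.map_X, chartQuotMap_X]
  -- the localized factorisation hypothesis: a chart element reducing to `θ (π(Y))` lies in `𝔴` iff a lift of `π` evaluated at the
  -- chart letter does (they differ by an element of `(c_i) ⊆ 𝔴`)
  have hfac' : ∀ π : (ResidueField R)[X], Prime π →
      (∃ b ∈ 𝔴, Ideal.Quotient.mk (Ideal.span {chartBase c i (c i)}) b =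
        θ ((Polynomial.aeval (MvPolynomial.X (⟨i', fun h => hii' h.symm⟩ : {j : Fin 3 // j ≠ i})) :
          (ResidueField R)[X] →ₐ[ResidueField R] MvPolynomial {j : Fin 3 // j ≠ i} (ResidueField R)).toRingHom π)) →
      ∃ (μ : ℕ) (G₀ : (ResidueField R)[X]),
      P μ ∧ (∑ k ∈ Finset.range (d + 1), C (residue R (a k)) * X ^ (u k)) = π ^ μ * G₀ ∧ ¬ π ∣ G₀ := by
    intro π hπ hb
    obtain ⟨b, hb𝔴, hbθ⟩ := hb
    refine hfac π hπ fun πR hπR => ?_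
    -- `mk (πR(e_{i'})) = θ (π(Y))`
    have hev : Ideal.Quotient.mk (Ideal.span {chartBase c i (c i)}) (πR.eval₂ (chartBase c i) (chartGen c i i')) =
        θ ((Polynomial.aeval (MvPolynomial.X (⟨i', fun h => hii' h.symm⟩ : {j : Fin 3 // j ≠ i})) :
          (ResidueField R)[X] →ₐ[ResidueField R] MvPolynomial {j : Fin 3 // j ≠ i} (ResidueField R)).toRingHom π) := by
      rw [← hπR, Polynomial.hom_eval₂, AlgHom.toRingHom_eq_coe, RingHom.coe_coe, Polynomial.aeval_def, Polynomial.eval₂_map,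
        MvPolynomial.algebraMap_eq, show (θ : _ ≃+* _) (πR.eval₂ ((MvPolynomial.C : ResidueField R →+* _).comp (residue R))
          (MvPolynomial.X (⟨i', fun h => hii' h.symm⟩ : {j : Fin 3 // j ≠ i}))) =
          θ.toRingHom (πR.eval₂ ((MvPolynomial.C : ResidueField R →+* _).comp (residue R))
          (MvPolynomial.X (⟨i', fun h => hii' h.symm⟩ : {j : Fin 3 // j ≠ i}))) from rfl, Polynomial.hom_eval₂]
      have hfg : (Ideal.Quotient.mk (Ideal.span {chartBase c i (c i)})).comp (chartBase c i) =
          θ.toRingHom.comp ((MvPolynomial.C : ResidueField R →+* _).comp (residue R)) :=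
        RingHom.ext fun r => by simp only [RingHom.comp_apply, RingEquiv.toRingHom_eq_coe, RingHom.coe_coe, hθC]
      rw [hfg]
      congr 1
      exact (hθX ⟨i', fun h => hii' h.symm⟩).symm
    have hdiff : πR.eval₂ (chartBase c i) (chartGen c i i') - b ∈ Ideal.span {chartBase c i (c i)} := by
      rw [← Ideal.Quotient.eq, hev, hbθ]
    have hsum := 𝔴.add_mem (hK𝔴' hdiff) hb𝔴
    convert hsum using 1
    abel
  exact exists_core_data_of_chartDatum_at (chartBase c i) (algebraMap (chartRing c i) L) (chartBase c i (c i))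
    (chartGen c i) hi hi' hii' θ hθC hθX 𝔴 hci𝔴 he2𝔴
    (fun b => IsLocalization.AtPrime.to_map_mem_maximal_iff L 𝔴 b)
    (fun b => (IsLocalization.AtPrime.isUnit_to_map_iff L 𝔴 b).trans Iff.rfl)
    (IsLocalization.AtPrime.map_eq_maximalIdeal 𝔴 L).symm h3L a u hfac'



/-! ## 3. A non-dropping child sits over a `κ`-rational heavy root -/

/-- **[OURS · L1 W4.6 rung (iii-2), every `p`] THE EXPONENT DROPS, OR THE CHILD LIES OVER A HEAVY ROOT.** `R → L` (`ψ`) the stalk map at a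
point of the blow-up of a window point presented through the Rees chart `i ∈ {0, 1}` (free letter `i′`), `L` of embedding dimension `3`
and characteristic `p`; the transform ideal `I′ = ((ψ g) : (ψ c_i)^p)` of `g = c₂^p + Σ a_k c_i^{d−u_k} c_{i′}^{u_k}` (`p < d < 2p`) singular
and with a window presentation `I′ = (z₁^p + Σ a′_k x₁^{d₁−k} y₁^k)`, `p < d₁ < 2p`. Then EITHER `d₁ < d`, OR there is `λ ∈ R` such that
`(ᾱ X + β̄)^p` divides the residue polynomial `Σ ā_k X^{u_k}` for some `α, β ∈ R`, `α` a unit (the centre is HEAVY, with `κ`-rational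
heavy root `λ̄ = −β̄/ᾱ`) AND `α · (c_{i′}/c_i) + β ∈ 𝔴` (the point lies on the exceptional line at `λ̄`). By `exists_core_data_at` with
`P μ := μ < p` and res-D-pv-050's `core_le_window`. NOT a statement of the manuscript. [folklore] -/
theorem exponent_lt_or_heavyRoot_of_chart (p : ℕ) [Fact p.Prime]
    (h3 : (maximalIdeal R).spanFinrank = 3) (c : Fin 3 → R) (hc : Ideal.span (Set.range c) = maximalIdeal R)
    {i i' : Fin 3} (hi : i ≠ 2) (hi' : i' ≠ 2) (hii' : i ≠ i') {d : ℕ} (hpd : p < d) (hd2 : d < 2 * p) (a : ℕ → R)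
    (u : ℕ → ℕ) (hu : ∀ k, u k ≤ d) (hunit : ∃ j ≤ d, IsUnit (a j)) (huinj : ∀ k ≤ d, ∀ k' ≤ d, u k = u k' → k = k')
    (𝔴 : Ideal (chartRing c i)) [𝔴.IsPrime] (h𝔴 : 𝔴.comap (chartBase c i) = maximalIdeal R)
    (L : Type u) [CommRing L] [IsLocalRing L] [Algebra (chartRing c i) L] [IsLocalization.AtPrime L 𝔴] [CharP L p]
    (h3L : (maximalIdeal L).spanFinrank = 3) (ψ : R →+* L)
    (hψ : ∀ r, ψ r = (algebraMap (chartRing c i) L : chartRing c i →+* L) (chartBase c i r))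
    {I' : Ideal L}
    (hI' : I' = Submodule.colon (Ideal.span {ψ (c 2 ^ p + ∑ k ∈ Finset.range (d + 1), a k * c i ^ (d - u k) * c i' ^ (u k))})
      ((Ideal.span {ψ (c i)} ^ p : Ideal L) : Set L))
    (hsing : I' ≤ maximalIdeal L ^ p) {x₁ y₁ z₁ : L} (hxyz₁ : Ideal.span {x₁, y₁, z₁} = maximalIdeal L) {d₁ : ℕ}
    (hpd₁ : p < d₁) (hd2₁ : d₁ < 2 * p) (a₁ : ℕ → L)
    (hI₁ : I' = Ideal.span {z₁ ^ p + ∑ k ∈ Finset.range (d₁ + 1), a₁ k * x₁ ^ (d₁ - k) * y₁ ^ k}) :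
    d₁ < d ∨ ∃ α β : R, IsUnit α ∧
      (C (residue R α) * X + C (residue R β)) ^ p ∣ ∑ k ∈ Finset.range (d + 1), C (residue R (a k)) * X ^ (u k) ∧
      chartBase c i α * chartGen c i i' + chartBase c i β ∈ 𝔴 := by
  classical
  by_cases hheavy : ∃ α β : R, IsUnit α ∧
      (C (residue R α) * X + C (residue R β)) ^ p ∣ ∑ k ∈ Finset.range (d + 1), C (residue R (a k)) * X ^ (u k) ∧
      chartBase c i α * chartGen c i i' + chartBase c i β ∈ 𝔴
  · exact Or.inr hheavy
  left
  have hp1 : 1 ≤ p := (Fact.out : p.Prime).one_lt.le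
  have hp2 : 2 ≤ p := (Fact.out : p.Prime).two_le
  set alg : chartRing c i →+* L := (algebraMap (chartRing c i) L : chartRing c i →+* L) with halg
  -- `L` is regular, `ψ (c i)` is a non-zero regular parameter
  have hz0 : Ideal.span (Set.range (Fin.append c (fun k : Fin 0 => Fin.elim0 k : Fin 0 → R))) = maximalIdeal R := by
    rw [span_range_append_elim0]; exact hc
  have hd0 : (maximalIdeal R).spanFinrank = 3 + 0 := by rw [h3]
  have hrsop := isRsopPart_chartFamily_reesChart c i (fun k : Fin 0 => Fin.elim0 k) hz0 hd0 𝔴 h𝔴 L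
    (a := 0) (fun k : Fin 0 => Fin.elim0 k) (Function.injective_of_subsingleton _) (fun k => Fin.elim0 k)
  haveI hLreg : IsRegularLocalRing L := hrsop.isRegularLocalRing
  haveI : IsDomain L := isDomain_of_isRegularLocalRing L
  have hci : ψ (c i) ∈ maximalIdeal L := by
    have h0 := hrsop.mem_maximalIdeal 0
    rw [hψ]; simpa only [chartFamily, Fin.cons_zero] using h0
  have hci0 : ψ (c i) ≠ 0 := by
    have h0 := hrsop.ne_zero 0
    rw [hψ]; simpa only [chartFamily, Fin.cons_zero] using h0
  have hrel : ∀ l, ψ (c l) = ψ (c i) * alg (chartGen c i l) := fun l => by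
    rw [hψ, hψ, halg, ← map_mul, ← reesChartBase_apply_eq_mul_chartGen c i l]
  set f : L := ∑ k ∈ Finset.range (d + 1), alg (chartBase c i (a k)) * alg (chartGen c i i') ^ (u k) with hf
  have hfψ : ∑ k ∈ Finset.range (d + 1), ψ (a k) * alg (chartGen c i i') ^ (u k) = f := by
    rw [hf]; refine Finset.sum_congr rfl fun k _ => ?_; rw [hψ]
  have hfac := map_window_eq_chart ψ (hrel i') (hrel 2) hpd.le a u hu
  rw [hfψ] at hfac
  set g₁ : L := alg (chartGen c i 2) ^ p + ψ (c i) ^ (d - p) * f with hg₁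
  have hI'eq : I' = Ideal.span {g₁} := by
    rw [hI', hfac, colon_span_pow_mul (mem_nonZeroDivisors_of_ne_zero hci0)]
  have hg₁m : g₁ ∈ maximalIdeal L := by
    have : g₁ ∈ I' := by rw [hI'eq]; exact Ideal.mem_span_singleton_self _
    exact Ideal.pow_le_self (by omega) (hsing this)
  have hz : alg (chartGen c i 2) ∈ maximalIdeal L := by
    have h1 : ψ (c i) ^ (d - p) * f ∈ maximalIdeal L :=
      Ideal.mul_mem_right _ _ (Ideal.pow_mem_of_mem _ hci _ (Nat.sub_pos_of_lt hpd))
    have h2 : alg (chartGen c i 2) ^ p ∈ maximalIdeal L := by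
      have := Ideal.sub_mem _ hg₁m h1
      rwa [hg₁, add_sub_cancel_right] at this
    exact Ideal.IsPrime.mem_of_pow_mem inferInstance p h2
  -- the residue polynomial is nonzero of degree `≤ d`
  set F : (ResidueField R)[X] := ∑ k ∈ Finset.range (d + 1), C (residue R (a k)) * X ^ (u k) with hF
  have hF0 : F ≠ 0 := by
    obtain ⟨k₀, hk₀, hk₀u⟩ := hunit
    intro h
    have := coeff_residuePoly d (fun k => residue R (a k)) u huinj hk₀
    rw [← hF, h, coeff_zero] at this
    exact (residue_ne_zero_iff_isUnit _).mpr hk₀u this.symm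
  have hFdeg : F.natDegree ≤ d := natDegree_residuePoly_le d _ u hu
  -- the LOCALIZED factorisation hypothesis with `P μ := μ < p`: a prime under the point of multiplicity `≥ p` is a rational heavy root
  have hfacP : ∀ π : (ResidueField R)[X], Prime π →
      (∀ πR : R[X], Polynomial.map (residue R) πR = π → πR.eval₂ (chartBase c i) (chartGen c i i') ∈ 𝔴) →
      ∃ (μ : ℕ) (G₀ : (ResidueField R)[X]), μ < p ∧ F = π ^ μ * G₀ ∧ ¬ π ∣ G₀ := by
    intro π hπ hloc
    obtain ⟨μ, G₀, hndvd, hFeq⟩ := WfDvdMonoid.max_power_factor' hF0 hπ.not_unit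
    refine ⟨μ, G₀, ?_, hFeq, hndvd⟩
    by_contra hμ
    push Not at hμ
    apply hheavy
    -- degree count: `deg π · μ ≤ d < 2p`, `μ ≥ p ≥ 2` ⇒ `deg π = 1`
    have hπ0 : π ≠ 0 := hπ.ne_zero
    have hG₀0 : G₀ ≠ 0 := by rintro rfl; exact hF0 (by rw [hFeq, mul_zero])
    have hπdeg : 1 ≤ π.natDegree := natDegree_pos_iff_degree_pos.mpr (degree_pos_of_irreducible hπ.irreducible)
    have hdeg : μ * π.natDegree + G₀.natDegree ≤ d := by
      have := hFdeg
      rw [hFeq, natDegree_mul (pow_ne_zero _ hπ0) hG₀0, natDegree_pow] at this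
      exact this
    have hπ1 : π.natDegree = 1 := by
      by_contra hne
      have h2 : 2 ≤ π.natDegree := by omega
      have : p * 2 ≤ μ * π.natDegree := Nat.mul_le_mul hμ h2
      omega
    obtain ⟨α, hα, β, hπeq⟩ := natDegree_eq_one.mp hπ1
    -- lifts of `α, β`; the lift `C α̃ X + C β̃` of `π` evaluates into `𝔴`
    obtain ⟨αR, hαR⟩ := Ideal.Quotient.mk_surjective (I := maximalIdeal R) α
    obtain ⟨βR, hβR⟩ := Ideal.Quotient.mk_surjective (I := maximalIdeal R) β
    have hαR' : residue R αR = α := hαR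
    have hβR' : residue R βR = β := hβR
    have hαRu : IsUnit αR := (residue_ne_zero_iff_isUnit _).mp (by rw [hαR']; exact hα)
    have hev : (C αR * X + C βR).eval₂ (chartBase c i) (chartGen c i i') ∈ 𝔴 := by
      refine hloc _ ?_
      rw [Polynomial.map_add, Polynomial.map_mul, Polynomial.map_C, Polynomial.map_X, Polynomial.map_C, ← hπeq, hαR', hβR']
    rw [eval₂_add, eval₂_mul, eval₂_C, eval₂_X, eval₂_C] at hev
    refine ⟨αR, βR, hαRu, ?_, hev⟩
    rw [hαR', hβR', hπeq, hFeq]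
    exact (pow_dvd_pow π hμ).trans (Dvd.intro G₀ rfl)
  -- the data of `core` at the point, with `μ < p`
  obtain ⟨-, ρ, G, μ, hμp, hGu, hgen, hfρ⟩ := exists_core_data_at h3 c hc hi hi' hii' a u 𝔴 h𝔴 hfacP L h3L hz
  rw [← hψ] at hgen hfρ
  rw [← hf] at hfρ
  -- the upstairs presentation in the shape of `core`
  have hz₁ : z₁ ∈ maximalIdeal L :=
    hxyz₁ ▸ Ideal.subset_span (Set.mem_insert_of_mem _ (Set.mem_insert_of_mem _ (Set.mem_singleton _)))
  have hf₁ : ∑ k ∈ Finset.range (d₁ + 1), a₁ k * x₁ ^ (d₁ - k) * y₁ ^ k ∈ maximalIdeal L ^ d₁ := by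
    have hle : Ideal.span {x₁, y₁} ≤ maximalIdeal L := by
      rw [← hxyz₁]
      refine Ideal.span_mono ?_
      intro b hb
      rcases hb with rfl | rfl
      · exact Set.mem_insert _ _
      · exact Set.mem_insert_of_mem _ (Set.mem_insert _ _)
    exact Ideal.pow_right_mono hle d₁ (coeffForm_mem_span_pow x₁ y₁ d₁ a₁)
  have heq : Ideal.span {alg (chartGen c i 2) ^ p + ψ (c i) ^ (d - p) * f} =
      Ideal.span {z₁ ^ p + ∑ k ∈ Finset.range (d₁ + 1), a₁ k * x₁ ^ (d₁ - k) * y₁ ^ k} := by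
    rw [← hg₁, ← hI'eq, hI₁]
  have := core_le_window p h3L hgen hpd hd2 hGu hfρ hz₁ hf₁ hpd₁ hd2₁ heq
  omega

/-! ## 4. Scheme level: any chart presentation of a non-dropping singular point over the centre -/

section Local

open CategoryTheory AlgebraicGeometry TopologicalSpace
open Literature.AlgebraicGeometry.Hironaka2017.S02Preliminaries Scheme.IdealSheafData

variable {X₀ X' : Scheme.{u}} {π : X' ⟶ X₀}

set_option maxHeartbeats 800000 in
-- the chart rings over `CommRingCat.of` stalks elaborate large terms (as in the tree's `IsBlowup.exists_chart_morphism`)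
/-- **[OURS · L1 W4.6 rung (iii-2), every `p`] A NON-DROPPING SINGULAR POINT OVER A WINDOW CENTRE LIES OVER A `κ`-RATIONAL HEAVY ROOT**
(scheme level, ANY chart presentation `q : Spec B_j → X′` through the point). Centre point `s` with coefficient window presentation
`J_s = (c₂^p + Σ_{k ≤ d} a_k c₀^{d−k} c₁^k)`, `p < d < 2p`, `𝓘_{Y,s} = 𝔪_s = (c₀, c₁, c₂)`; a point `x′` over `s` presented through the chart
`j`, at which the controlled transform has order `≥ p` AND a coefficient window presentation of exponent `d₁ ≥ d` (NO DROP), the local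
ring at `x′` of embedding dimension `3` and characteristic `p`. Then `j ≠ 2` and, in the chart `j` (free letter `j′`, exponents `u`),
the prime of `x′` contains `c_j` and `c₂/c_j` (the exceptional line) and there are `α, β ∈ 𝒪_{X,s}`, `α` a unit, with
`(ᾱ X + β̄)^p ∣ Σ ā_k X^{u_k}` (a `κ`-RATIONAL HEAVY ROOT `−β̄/ᾱ` of the centre) and `α · (c_{j′}/c_j) + β` in the prime of `x′` (the point
lies on the exceptional line AT that root). NOT a statement of the manuscript.
[cite: StacksProject, Tag 0804] -/
theorem heavyRoot_of_le_exponent [IsLocallyNoetherian X'] (p : ℕ) [Fact p.Prime] {Y : Closeds X₀} {J : X₀.IdealSheafData}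
    {s : X₀} {x' : X'} (hx : π x' = s) [IsRegularLocalRing (X₀.presheaf.stalk s)]
    (hdim : (maximalIdeal (X₀.presheaf.stalk s)).spanFinrank = 3)
    (c : Fin 3 → X₀.presheaf.stalk s) (hc : Ideal.span (Set.range c) = maximalIdeal _)
    (hY : stalkIdeal (vanishingIdeal Y) s = maximalIdeal _) {d : ℕ} (hpd : p < d) (hd2 : d < 2 * p)
    (a : ℕ → X₀.presheaf.stalk s) (hunit : ∃ k ≤ d, IsUnit (a k))
    (hJ : stalkIdeal J s = Ideal.span {c 2 ^ p + ∑ k ∈ Finset.range (d + 1), a k * c 0 ^ (d - k) * c 1 ^ k})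
    (j : Fin 3) (q : Spec (.of (chartRing c j)) ⟶ X') (w : Spec (.of (chartRing c j))) (hq : q w = x')
    [IsIso (q.stalkMap w)]
    (hsq : q ≫ π = Spec.map (CommRingCat.ofHom (chartBase c j)) ≫ X₀.fromSpecStalk s)
    (hle : (p : ℕ∞) ≤ idealOrder (controlledTransform π (vanishingIdeal Y) J p) x')
    [CharP (X'.presheaf.stalk x') p] (h3L : (maximalIdeal (X'.presheaf.stalk x')).spanFinrank = 3)
    {x₁ y₁ z₁ : X'.presheaf.stalk x'} (hxyz₁ : Ideal.span {x₁, y₁, z₁} = maximalIdeal _) {d₁ : ℕ} (hpd₁ : p < d₁)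
    (hd2₁ : d₁ < 2 * p) (a₁ : ℕ → X'.presheaf.stalk x')
    (hJ₁ : stalkIdeal (controlledTransform π (vanishingIdeal Y) J p) x' =
      Ideal.span {z₁ ^ p + ∑ k ∈ Finset.range (d₁ + 1), a₁ k * x₁ ^ (d₁ - k) * y₁ ^ k})
    (hdd : d ≤ d₁) :
    j ≠ 2 ∧ chartBase c j (c j) ∈ w.asIdeal ∧ chartGen c j 2 ∈ w.asIdeal ∧ ∃ α β : X₀.presheaf.stalk s, IsUnit α ∧
      (C (residue _ α) * Polynomial.X + C (residue _ β)) ^ p ∣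
        ∑ k ∈ Finset.range (d + 1), C (residue _ (a k)) *
          Polynomial.X ^ ((![fun k => min k d, fun k => d - k, fun _ => 0] : Fin 3 → ℕ → ℕ) j k) ∧
      chartBase c j α * chartGen c j ((![1, 0, 0] : Fin 3 → Fin 3) j) + chartBase c j β ∈ w.asIdeal := by
  classical
  subst hx
  obtain ⟨χ, hχ₀, hloc, h𝔴⟩ :=
    exists_stalk_ringHom_of_chart π x' (CommRingCat.ofHom (chartBase c j)) q w hq hsq
  have hχ : ∀ r, χ (chartBase c j r) = (π.stalkMap x').hom r := fun r => hχ₀ r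
  have h𝔴' : w.asIdeal.comap (chartBase c j) = maximalIdeal (X₀.presheaf.stalk (π x')) := h𝔴
  clear hχ₀ h𝔴
  letI := χ.toAlgebra
  haveI : IsLocalization.AtPrime (X'.presheaf.stalk x') w.asIdeal := hloc
  obtain ⟨ψ, hψ⟩ : ∃ ψ : X₀.presheaf.stalk (π x') →+* X'.presheaf.stalk x', ψ = (π.stalkMap x').hom := ⟨_, rfl⟩
  have hψa : ∀ r, ψ r = (algebraMap (chartRing c j) (X'.presheaf.stalk x') :
      chartRing c j →+* X'.presheaf.stalk x') (chartBase c j r) := fun r => by rw [hψ]; exact (hχ r).symm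
  have hrel : ∀ l, ψ (c l) = ψ (c j) * χ (chartGen c j l) := by
    rw [hψ]; exact stalkMap_apply_eq_mul_chartGen j χ hχ
  have hcY : Ideal.span (Set.range c) = stalkIdeal (vanishingIdeal Y) (π x') := hc.trans hY.symm
  have hCmap : (stalkIdeal (vanishingIdeal Y) (π x')).map ψ = Ideal.span {ψ (c j)} := by
    rw [← hcY, Ideal.map_span_range_eq_span_singleton _ c j _ hrel]
  have hstalk : stalkIdeal (controlledTransform π (vanishingIdeal Y) J p) x' =
      Submodule.colon (Ideal.span {ψ (c 2 ^ p + ∑ k ∈ Finset.range (d + 1), a k * c 0 ^ (d - k) * c 1 ^ k)})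
        ((Ideal.span {ψ (c j)} ^ p : Ideal _) : Set _) := by
    rw [controlledTransform, stalkIdeal_colon, stalkIdeal_pow, stalkIdeal_comap_eq_map_stalkMap,
      stalkIdeal_comap_eq_map_stalkMap, ← hψ, hCmap, hJ, Ideal.map_span, Set.image_singleton]
  have hsing : Submodule.colon (Ideal.span {ψ (c 2 ^ p + ∑ k ∈ Finset.range (d + 1), a k * c 0 ^ (d - k) * c 1 ^ k)})
      ((Ideal.span {ψ (c j)} ^ p : Ideal _) : Set _) ≤ maximalIdeal (X'.presheaf.stalk x') ^ p := by
    rw [← hstalk]; exact (le_idealOrder_iff _ x' p).mp hle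
  have hcj : chartBase c j (c j) ∈ w.asIdeal := by
    rw [← Ideal.mem_comap, h𝔴', ← hc]; exact Ideal.subset_span ⟨j, rfl⟩
  have hbd : p < 2 * p := by omega
  -- which chart?
  obtain rfl | rfl | rfl : j = 0 ∨ j = 1 ∨ j = 2 := by
    rcases j with ⟨j, hj⟩
    have : j = 0 ∨ j = 1 ∨ j = 2 := by omega
    rcases this with rfl | rfl | rfl
    · exact Or.inl rfl
    · exact Or.inr (Or.inl rfl)
    · exact Or.inr (Or.inr rfl)
  · rw [window_sum_chart_zero] at hsing
    have h2 := (mem_line_of_singular_chart hdim c hc (i := 0) (i' := 1) hpd hd2 a (fun k => min k d) (fun k => min_le_right k d)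
      w.asIdeal h𝔴' (X'.presheaf.stalk x') ψ hψa hsing).1
    rcases exponent_lt_or_heavyRoot_of_chart p hdim c hc (i := 0) (i' := 1) (by decide) (by decide) (by decide) hpd hd2 a
        (fun k => min k d) (fun k => min_le_right k d) hunit
        (fun k hk k' hk' hkk' => by rwa [min_eq_left hk, min_eq_left hk'] at hkk') w.asIdeal h𝔴' (X'.presheaf.stalk x') h3L ψ hψa
        rfl hsing hxyz₁ hpd₁ hd2₁ a₁ (by rw [← window_sum_chart_zero, ← hstalk, hJ₁]) with hlt | ⟨α, β, hα, hdvd, hmem⟩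
    · exact absurd hdd (not_le.mpr hlt)
    · refine ⟨by decide, hcj, h2, α, β, hα, ?_, ?_⟩
      · simpa only [Matrix.cons_val_zero] using hdvd
      · simpa only [Matrix.cons_val_zero] using hmem
  · rw [window_sum_chart_one] at hsing
    have h2 := (mem_line_of_singular_chart hdim c hc (i := 1) (i' := 0) hpd hd2 a (fun k => d - k) (fun k => Nat.sub_le d k)
      w.asIdeal h𝔴' (X'.presheaf.stalk x') ψ hψa hsing).1
    rcases exponent_lt_or_heavyRoot_of_chart p hdim c hc (i := 1) (i' := 0) (by decide) (by decide) (by decide) hpd hd2 a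
        (fun k => d - k) (fun k => Nat.sub_le d k) hunit (fun k hk k' hk' hkk' => by omega) w.asIdeal h𝔴' (X'.presheaf.stalk x')
        h3L ψ hψa rfl hsing hxyz₁ hpd₁ hd2₁ a₁ (by rw [← window_sum_chart_one, ← hstalk, hJ₁]) with hlt | ⟨α, β, hα, hdvd, hmem⟩
    · exact absurd hdd (not_le.mpr hlt)
    · refine ⟨by decide, hcj, h2, α, β, hα, ?_, ?_⟩
      · simpa only [Matrix.cons_val_one, Matrix.cons_val_zero] using hdvd
      · simpa only [Matrix.cons_val_one, Matrix.cons_val_zero] using hmem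
  · exact (not_singular_chart_two hdim c hc (by omega) hpd a w.asIdeal h𝔴' (X'.presheaf.stalk x') ψ hψa hsing).elim

end Local

end Summit.ResolutionOfSingularities.ResolutionOfSingularities.Theorems.CampaignW46.MohWindowSurface

end
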